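import Mathlib
import Summits.KontsevichZagierPeriods.Zeta5Search.RecordCellAAtlasNotMin
import HarnessLib

/-!
# ζ(5) search — the CLASS ATLAS of the Brown–Zudilin record ray `b(n) = n·(41;17,…,11)` at the primes `7n < p < 7.5n` (census cell D)

Cell `pub-zeta5` (HONEST FRAMING: systematic search; no irrationality claim unless certified), P1 prover seat
generation 6; the combinatorial half of the Lean proof of census g11's `CellAtlas.RecordCellD`.  For `n ≥ 1` and `14n < 2p < 15n`
(`6p > 41n ≥ 5p + …`, so every residue class modulo `p` in `[0, 41n]` has five or six points `x < x+p < … < x+4p (< x+5p)`):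

* the classes (`classSet_bRecD`, the two exponent-sum expansions);
* the MINIMAL multipole classes (class exponent `−8`, gen-2 g9's `RecordCellDClassData`): `MinT1` (type `(1,−1,−6,−3,1)`:
  `12n ≤ x+p`, `x+3p ≤ 27n`, `41n < x+5p`), `MinS` (the palindromic type `(1,−2,−6,−2,1)`: `13n ≤ x+p`, `x+3p ≤ 28n`, not
  self-conjugate `2x+4p ≠ 41n`) and `MinT2` (type `(1,−3,−6,−1,1)`: `14n ≤ x+p`, `x+3p ≤ 29n`) = the conjugates `41n − (x+4p)` of
  `MinT1`, with their net exponents for `b(n)` AND `b(n) + e₇` (`netExp_minT1`, `netExp_minS`, `netExp_minT2`) and the centre-freeness;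
* (part 2, `RecordCellDAtlasNotMin.lean`) every OTHER class has class exponent `≥ −7`.
The proof runs in the coordinates `y_k = x + k(p − 7n)` (`0 < 2(p−7n) < n`), in which the type of a class is read off the position of
`y₁,…,y₅` in the grid `nℤ`.  Exact arithmetic on the ray (all `n`); cross-checked against an independent partial-fraction kernel at the seven
record primes with `n ≤ 10` (`code/p1/g6/cellD_check.py`).  Nothing about irrationality.
-/

open Finset

namespace Summit.KontsevichZagierPeriods.Zeta5Search.CellD

open Summit.KontsevichZagierPeriods.Zeta5Search.ClusterValuation
open Summit.KontsevichZagierPeriods.Zeta5Search.CasoratianValuation (shift)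
open Summit.KontsevichZagierPeriods.Zeta5Search.BigPrime (block shift_zero)
open Summit.KontsevichZagierPeriods.Zeta5Search.CellA

/-! ### §1 Two more entries of the depth table -/

/-- The deep well: all seven blocks contain `q ∈ [17n, 24n]`. -/
theorem dep7_well {n q : ℕ} (h1 : 17 * n ≤ q) (h2 : q ≤ 24 * n) : dep7 n q = 7 := by
  unfold dep7; split_ifs <;> omega

/-- The net exponent at the even centre `2q = 41n`: `1 − 7 + 1 = −5`. -/
theorem netExp_centre {n q : ℕ} (hc : 2 * q = 41 * n) : netExp (bRec n) q = -5 := by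
  rw [netExp_bRec, dep7_well (by omega) (by omega), if_pos hc]; norm_num

/-! ### §2 The residue classes for `14n < 2p < 15n` -/

section Classes

variable {n p : ℕ} (hp : 14 * n < 2 * p) (hp' : 2 * p < 15 * n)

include hp hp' in
/-- **The class of `x < p`**: `{x, x+p, …, x+5p}` if `x + 5p ≤ 41n`, else `{x, x+p, …, x+4p}`. -/
theorem classSet_bRecD {x : ℕ} (hx : x < p) :
    classSet (bRec n) p x = if x + 5 * p ≤ 41 * n then {x, x + p, x + 2 * p, x + 3 * p, x + 4 * p, x + 5 * p}
      else {x, x + p, x + 2 * p, x + 3 * p, x + 4 * p} := by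
  ext s
  rw [mem_classSet_iff, bRec_zero_toNat]
  have key : (s ≤ 41 * n ∧ (p : ℤ) ∣ (s : ℤ) - x) ↔
      (s = x ∨ s = x + p ∨ s = x + 2 * p ∨ s = x + 3 * p ∨ s = x + 4 * p ∨ (s = x + 5 * p ∧ x + 5 * p ≤ 41 * n)) := by
    constructor
    · rintro ⟨hs, k, hk⟩
      have hk0 : 0 ≤ k := by
        by_contra hneg
        push Not at hneg
        have : (p : ℤ) * k ≤ (p : ℤ) * (-1) := mul_le_mul_of_nonneg_left (by omega) (by omega)
        omega
      have hk6 : k < 6 := by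
        by_contra hge
        push Not at hge
        have : (p : ℤ) * 6 ≤ (p : ℤ) * k := mul_le_mul_of_nonneg_left hge (by omega)
        omega
      interval_cases k <;> omega
    · rintro (rfl | rfl | rfl | rfl | rfl | ⟨rfl, h⟩)
      · exact ⟨by omega, 0, by ring⟩
      · exact ⟨by omega, 1, by push_cast; ring⟩
      · exact ⟨by omega, 2, by push_cast; ring⟩
      · exact ⟨by omega, 3, by push_cast; ring⟩
      · exact ⟨by omega, 4, by push_cast; ring⟩
      · exact ⟨h, 5, by push_cast; ring⟩
  rw [key]
  split_ifs with h6
  · simp only [mem_insert, mem_singleton]; tauto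
  · simp only [mem_insert, mem_singleton]
    constructor
    · rintro (h | h | h | h | h | ⟨h, h'⟩)
      · exact Or.inl h
      · exact Or.inr (Or.inl h)
      · exact Or.inr (Or.inr (Or.inl h))
      · exact Or.inr (Or.inr (Or.inr (Or.inl h)))
      · exact Or.inr (Or.inr (Or.inr (Or.inr h)))
      · exact absurd h' h6
    · rintro (h | h | h | h | h)
      · exact Or.inl h
      · exact Or.inr (Or.inl h)
      · exact Or.inr (Or.inr (Or.inl h))
      · exact Or.inr (Or.inr (Or.inr (Or.inl h)))
      · exact Or.inr (Or.inr (Or.inr (Or.inr (Or.inl h))))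

include hp in
omit hp' in
/-- The sum of a function over the five-point class. -/
theorem sum_five {x : ℕ} (f : ℕ → ℤ) :
    ∑ s ∈ ({x, x + p, x + 2 * p, x + 3 * p, x + 4 * p} : Finset ℕ), f s =
      f x + f (x + p) + f (x + 2 * p) + f (x + 3 * p) + f (x + 4 * p) := by
  have hp0 : 0 < p := by omega
  rw [sum_insert (by simp; omega), sum_insert (by simp; omega), sum_insert (by simp; omega), sum_pair (by omega)]
  ring

include hp in
omit hp' in
/-- The sum of a function over the six-point class. -/
theorem sum_six {x : ℕ} (f : ℕ → ℤ) :
    ∑ s ∈ ({x, x + p, x + 2 * p, x + 3 * p, x + 4 * p, x + 5 * p} : Finset ℕ), f s =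
      f x + f (x + p) + f (x + 2 * p) + f (x + 3 * p) + f (x + 4 * p) + f (x + 5 * p) := by
  have hp0 : 0 < p := by omega
  rw [sum_insert (by simp; omega), sum_insert (by simp; omega), sum_insert (by simp; omega), sum_insert (by simp; omega),
    sum_pair (by omega)]
  ring

include hp hp' in
/-- Five-point classes: the exponent sum is a lower bound for the class exponent. -/
theorem classExp_ge_five {x : ℕ} (hx : x < p) (h6 : ¬ x + 5 * p ≤ 41 * n) :
    netExp (bRec n) x + netExp (bRec n) (x + p) + netExp (bRec n) (x + 2 * p) + netExp (bRec n) (x + 3 * p) +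
      netExp (bRec n) (x + 4 * p) ≤ classExp (bRec n) p x := by
  refine le_trans (le_of_eq ?_) (classExp_ge_sum _ _ _)
  rw [classSet_bRecD hp hp' hx, if_neg h6, sum_five hp]

include hp hp' in
/-- Six-point classes: the exponent sum is a lower bound for the class exponent. -/
theorem classExp_ge_six {x : ℕ} (hx : x < p) (h6 : x + 5 * p ≤ 41 * n) :
    netExp (bRec n) x + netExp (bRec n) (x + p) + netExp (bRec n) (x + 2 * p) + netExp (bRec n) (x + 3 * p) +
      netExp (bRec n) (x + 4 * p) + netExp (bRec n) (x + 5 * p) ≤ classExp (bRec n) p x := by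
  refine le_trans (le_of_eq ?_) (classExp_ge_sum _ _ _)
  rw [classSet_bRecD hp hp' hx, if_pos h6, sum_six hp]

include hp hp' in
/-- **Centre-freeness**: a class `x < p` with `2x + 4p ≠ 41n` and `2x + 5p ≠ 41n` does not contain the centre residue. -/
theorem not_centreIn {x : ℕ} (hx : x < p) (h4 : 2 * x + 4 * p ≠ 41 * n) (h5 : 2 * x + 5 * p ≠ 41 * n) :
    ¬ CentreIn (bRec n) p x := by
  rintro ⟨k, hk⟩
  rw [bRec_zero] at hk
  have hk1 : -6 < k := by
    by_contra hle
    push Not at hle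
    have : (p : ℤ) * k ≤ (p : ℤ) * (-6) := mul_le_mul_of_nonneg_left hle (by omega)
    omega
  have hk2 : k < -3 := by
    by_contra hge
    push Not at hge
    have : (p : ℤ) * (-3) ≤ (p : ℤ) * k := mul_le_mul_of_nonneg_left hge (by omega)
    omega
  interval_cases k <;> omega

end Classes

/-! ### §3 The minimal multipole classes -/

/-- Type `(1,−1,−6,−3,1)`: `12n ≤ x+p`, `x+3p ≤ 27n`, no sixth point. -/
def MinT1 (n p : ℕ) : Finset ℕ := (range p).filter fun x => 12 * n ≤ x + p ∧ x + 3 * p ≤ 27 * n ∧ 41 * n < x + 5 * p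

/-- Type `(1,−2,−6,−2,1)`: `13n ≤ x+p`, `x+3p ≤ 28n`, not self-conjugate (`2x + 4p ≠ 41n`). -/
def MinS (n p : ℕ) : Finset ℕ := (range p).filter fun x => 13 * n ≤ x + p ∧ x + 3 * p ≤ 28 * n ∧ 2 * x + 4 * p ≠ 41 * n

/-- Type `(1,−3,−6,−1,1)`: `14n ≤ x+p`, `x+3p ≤ 29n` — the conjugates `41n − (x'+4p)` of the classes `x' ∈ MinT1`. -/
def MinT2 (n p : ℕ) : Finset ℕ := (range p).filter fun x => 14 * n ≤ x + p ∧ x + 3 * p ≤ 29 * n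

/-- All minimal multipole classes of cell D. -/
def MinAll (n p : ℕ) : Finset ℕ := MinT1 n p ∪ MinS n p ∪ MinT2 n p

/-- Membership in `MinT1`. -/
theorem mem_minT1 {n p x : ℕ} : x ∈ MinT1 n p ↔ x < p ∧ 12 * n ≤ x + p ∧ x + 3 * p ≤ 27 * n ∧ 41 * n < x + 5 * p := by
  simp [MinT1]

/-- Membership in `MinS`. -/
theorem mem_minS {n p x : ℕ} : x ∈ MinS n p ↔ x < p ∧ 13 * n ≤ x + p ∧ x + 3 * p ≤ 28 * n ∧ 2 * x + 4 * p ≠ 41 * n := by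
  simp [MinS]

/-- Membership in `MinT2`. -/
theorem mem_minT2 {n p x : ℕ} : x ∈ MinT2 n p ↔ x < p ∧ 14 * n ≤ x + p ∧ x + 3 * p ≤ 29 * n := by
  simp [MinT2]

/-- `MinAll ⊆ range p`. -/
theorem minAll_subset (n p : ℕ) : MinAll n p ⊆ range p := by
  intro x hx
  simp only [MinAll, mem_union, mem_minT1, mem_minS, mem_minT2] at hx
  rw [mem_range]
  rcases hx with (h | h) | h
  · exact h.1
  · exact h.1
  · exact h.1

/-- `MinT1` and `MinS` are disjoint. -/
theorem disjoint_minT1_minS (n p : ℕ) : Disjoint (MinT1 n p) (MinS n p) := by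
  rw [Finset.disjoint_left]
  intro x h1 h2
  rw [mem_minT1] at h1; rw [mem_minS] at h2
  omega

/-- `MinT1 ∪ MinS` and `MinT2` are disjoint. -/
theorem disjoint_minT1S_minT2 (n p : ℕ) : Disjoint (MinT1 n p ∪ MinS n p) (MinT2 n p) := by
  rw [Finset.disjoint_left]
  intro x h12 h3
  rw [mem_union, mem_minT1, mem_minS] at h12; rw [mem_minT2] at h3
  omega

section MinExps

variable {n p : ℕ} (hn : 1 ≤ n) (hp : 14 * n < 2 * p) (hp' : 2 * p < 15 * n)

include hp hp' in
/-- Net exponents of a class of `MinT1`: `(1,−1,−6,−3,1)`, also for `b(n) + e₇`; five points; centre-free. -/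
theorem netExp_minT1 {x : ℕ} (hx : x ∈ MinT1 n p) :
    (netExp (bRec n) x = 1 ∧ netExp (bRec n) (x + p) = -1 ∧ netExp (bRec n) (x + 2 * p) = -6 ∧
      netExp (bRec n) (x + 3 * p) = -3 ∧ netExp (bRec n) (x + 4 * p) = 1) ∧
    (netExp (shift (bRec n) 7) x = 1 ∧ netExp (shift (bRec n) 7) (x + p) = -1 ∧
      netExp (shift (bRec n) 7) (x + 2 * p) = -6 ∧ netExp (shift (bRec n) 7) (x + 3 * p) = -3 ∧
      netExp (shift (bRec n) 7) (x + 4 * p) = 1) ∧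
    x < p ∧ x + 4 * p ≤ 41 * n ∧ 41 * n < x + 5 * p ∧ 2 * x + 4 * p ≠ 41 * n ∧ 2 * x + 5 * p ≠ 41 * n := by
  rw [mem_minT1] at hx
  obtain ⟨hxp, h12, h27, h41⟩ := hx
  have e0 : netExp (bRec n) x = 1 := by
    rw [netExp_bRec_of_ne n x (by omega), dep7_low (by omega)]; norm_num
  have e1 : netExp (bRec n) (x + p) = -1 := by
    rw [netExp_bRec_of_ne n (x + p) (by omega), dep7_lower (by norm_num : 2 ≤ 7) (by omega) (by omega)]; norm_num
  have e2 : netExp (bRec n) (x + 2 * p) = -6 := by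
    rw [netExp_bRec_of_ne n (x + 2 * p) (by omega), dep7_well (by omega) (by omega)]; norm_num
  have e3 : netExp (bRec n) (x + 3 * p) = -3 := by
    rw [netExp_bRec_of_ne n (x + 3 * p) (by omega), dep7_upper (by norm_num : 4 ≤ 7) (by omega) (by omega)]; norm_num
  have e4 : netExp (bRec n) (x + 4 * p) = 1 := by
    rw [netExp_bRec_of_ne n (x + 4 * p) (by omega), dep7_high (by omega)]; norm_num
  refine ⟨⟨e0, e1, e2, e3, e4⟩, ⟨?_, ?_, ?_, ?_, ?_⟩, hxp, by omega, h41, by omega, by omega⟩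
  · rw [netExp_shift7 n x (by omega) (by omega), e0]
  · rw [netExp_shift7 n (x + p) (by omega) (by omega), e1]
  · rw [netExp_shift7 n (x + 2 * p) (by omega) (by omega), e2]
  · rw [netExp_shift7 n (x + 3 * p) (by omega) (by omega), e3]
  · rw [netExp_shift7 n (x + 4 * p) (by omega) (by omega), e4]

include hp hp' in
/-- Net exponents of a class of `MinS`: `(1,−2,−6,−2,1)`, also for `b(n) + e₇`; five points; centre-free. -/
theorem netExp_minS {x : ℕ} (hx : x ∈ MinS n p) :
    (netExp (bRec n) x = 1 ∧ netExp (bRec n) (x + p) = -2 ∧ netExp (bRec n) (x + 2 * p) = -6 ∧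
      netExp (bRec n) (x + 3 * p) = -2 ∧ netExp (bRec n) (x + 4 * p) = 1) ∧
    (netExp (shift (bRec n) 7) x = 1 ∧ netExp (shift (bRec n) 7) (x + p) = -2 ∧
      netExp (shift (bRec n) 7) (x + 2 * p) = -6 ∧ netExp (shift (bRec n) 7) (x + 3 * p) = -2 ∧
      netExp (shift (bRec n) 7) (x + 4 * p) = 1) ∧
    x < p ∧ x + 4 * p ≤ 41 * n ∧ 41 * n < x + 5 * p ∧ 2 * x + 4 * p ≠ 41 * n ∧ 2 * x + 5 * p ≠ 41 * n := by
  rw [mem_minS] at hx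
  obtain ⟨hxp, h13, h28, hself⟩ := hx
  have e0 : netExp (bRec n) x = 1 := by
    rw [netExp_bRec_of_ne n x (by omega), dep7_low (by omega)]; norm_num
  have e1 : netExp (bRec n) (x + p) = -2 := by
    rw [netExp_bRec_of_ne n (x + p) (by omega), dep7_lower (by norm_num : 3 ≤ 7) (by omega) (by omega)]; norm_num
  have e2 : netExp (bRec n) (x + 2 * p) = -6 := by
    rw [netExp_bRec_of_ne n (x + 2 * p) (by omega), dep7_well (by omega) (by omega)]; norm_num
  have e3 : netExp (bRec n) (x + 3 * p) = -2 := by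
    rw [netExp_bRec_of_ne n (x + 3 * p) (by omega), dep7_upper (by norm_num : 3 ≤ 7) (by omega) (by omega)]; norm_num
  have e4 : netExp (bRec n) (x + 4 * p) = 1 := by
    rw [netExp_bRec_of_ne n (x + 4 * p) (by omega), dep7_high (by omega)]; norm_num
  refine ⟨⟨e0, e1, e2, e3, e4⟩, ⟨?_, ?_, ?_, ?_, ?_⟩, hxp, by omega, by omega, hself, by omega⟩
  · rw [netExp_shift7 n x (by omega) (by omega), e0]
  · rw [netExp_shift7 n (x + p) (by omega) (by omega), e1]
  · rw [netExp_shift7 n (x + 2 * p) (by omega) (by omega), e2]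
  · rw [netExp_shift7 n (x + 3 * p) (by omega) (by omega), e3]
  · rw [netExp_shift7 n (x + 4 * p) (by omega) (by omega), e4]

include hp hp' in
/-- Net exponents of a class of `MinT2`: `(1,−3,−6,−1,1)`, also for `b(n) + e₇`; five points; centre-free. -/
theorem netExp_minT2 {x : ℕ} (hx : x ∈ MinT2 n p) :
    (netExp (bRec n) x = 1 ∧ netExp (bRec n) (x + p) = -3 ∧ netExp (bRec n) (x + 2 * p) = -6 ∧
      netExp (bRec n) (x + 3 * p) = -1 ∧ netExp (bRec n) (x + 4 * p) = 1) ∧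
    (netExp (shift (bRec n) 7) x = 1 ∧ netExp (shift (bRec n) 7) (x + p) = -3 ∧
      netExp (shift (bRec n) 7) (x + 2 * p) = -6 ∧ netExp (shift (bRec n) 7) (x + 3 * p) = -1 ∧
      netExp (shift (bRec n) 7) (x + 4 * p) = 1) ∧
    x < p ∧ x + 4 * p ≤ 41 * n ∧ 41 * n < x + 5 * p ∧ 2 * x + 4 * p ≠ 41 * n ∧ 2 * x + 5 * p ≠ 41 * n := by
  rw [mem_minT2] at hx
  obtain ⟨hxp, h14, h29⟩ := hx
  have e0 : netExp (bRec n) x = 1 := by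
    rw [netExp_bRec_of_ne n x (by omega), dep7_low (by omega)]; norm_num
  have e1 : netExp (bRec n) (x + p) = -3 := by
    rw [netExp_bRec_of_ne n (x + p) (by omega), dep7_lower (by norm_num : 4 ≤ 7) (by omega) (by omega)]; norm_num
  have e2 : netExp (bRec n) (x + 2 * p) = -6 := by
    rw [netExp_bRec_of_ne n (x + 2 * p) (by omega), dep7_well (by omega) (by omega)]; norm_num
  have e3 : netExp (bRec n) (x + 3 * p) = -1 := by
    rw [netExp_bRec_of_ne n (x + 3 * p) (by omega), dep7_upper (by norm_num : 2 ≤ 7) (by omega) (by omega)]; norm_num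
  have e4 : netExp (bRec n) (x + 4 * p) = 1 := by
    rw [netExp_bRec_of_ne n (x + 4 * p) (by omega), dep7_high (by omega)]; norm_num
  refine ⟨⟨e0, e1, e2, e3, e4⟩, ⟨?_, ?_, ?_, ?_, ?_⟩, hxp, by omega, by omega, by omega, by omega⟩
  · rw [netExp_shift7 n x (by omega) (by omega), e0]
  · rw [netExp_shift7 n (x + p) (by omega) (by omega), e1]
  · rw [netExp_shift7 n (x + 2 * p) (by omega) (by omega), e2]
  · rw [netExp_shift7 n (x + 3 * p) (by omega) (by omega), e3]
  · rw [netExp_shift7 n (x + 4 * p) (by omega) (by omega), e4]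

/-- The conjugation `x ↦ 41n − (x + 4p)` maps `MinT1` onto `MinT2` … -/
theorem conj_mem_minT2 {x : ℕ} (hx : x ∈ MinT1 n p) : 41 * n - (x + 4 * p) ∈ MinT2 n p := by
  rw [mem_minT1] at hx; rw [mem_minT2]; omega

/-- … and `MinT2` back onto `MinT1` … -/
theorem conj_mem_minT1 {x : ℕ} (hx : x ∈ MinT2 n p) : 41 * n - (x + 4 * p) ∈ MinT1 n p := by
  rw [mem_minT2] at hx; rw [mem_minT1]; omega

include hp in
/-- … and `MinS` onto itself. -/
theorem conj_mem_minS {x : ℕ} (hx : x ∈ MinS n p) : 41 * n - (x + 4 * p) ∈ MinS n p := by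
  rw [mem_minS] at hx ⊢; omega

end MinExps

end Summit.KontsevichZagierPeriods.Zeta5Search.CellD
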